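import Summits.CriticalPhenomena.PercolationContinuityZ3.Theorems.Transplant.FKConnectivityAllQAntipodalMinorGluing
import HarnessLib

/-!
# Connectivity correlation inequalities for `φ_{w,q}`, every `q > 0` — file 22c: the antipodal exponent of a TRIANGLE (cycle) of THREE
# two-terminal networks (the bridge identity of the S-median normal form of `maj₃`)

Support file (`--supports stmt-CriticalPhenomena-4575`), FK sub-lane `prim-bschramm-fk-2` (gen 24); builds on p205010 (kernel theorem,
internal audit signed; external expert review pending).  No definitions, no named facts, no sorries; standard axioms.

Companion of `…AntipodalThetaGluing.lean`.  The three-box normal form of the level-3 antipodal inequality (FK-Q2 §32–§33) has two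
assemblies: the theta (three networks in parallel between the poles) and the TRIANGLE `Δ(B₁, B₂, B₃)`: `B₁` between `a` and `m`, `B₂`
between `m` and `b`, `B₃` between `a` and `b`, i.e. the series composition `B₁ · B₂` closed up by `B₃` in parallel.  Iterating gen 11's
series and parallel gluing identities (`FK.apExpC_series`, `FK.apExpC_parallel`, `FK.reachable_union_series`):
* `FK.reachable_union_cycle3`: `a ↔ b` in `γ₁ ∪ γ₂ ∪ γ₃` iff (`a ↔ m` in `γ₁` and `m ↔ b` in `γ₂`) or `a ↔ b` in `γ₃`;
* `FK.apExpC_cycle3`: `apExpC (M₁∪M₂∪M₃) (C₁∪C₂∪C₃) (γ₁∪γ₂∪γ₃) + 4|V| = Σᵢ apExpC Mᵢ Cᵢ γᵢ + 1{c₁ ∧ c₂ ∧ c₃} + 1{c̄₁ ∧ c̄₂ ∧ c̄₃}`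
  (`cᵢ` / `c̄ᵢ` = the part joins ITS OWN two terminals in replica 1 / replica 2): the level of the triangle is additive in the boxes up to
  the junction term `[n = 3] + [n̄ = 3]` — one cycle closes exactly when all three boxes join their terminals.
[cite: Grimmett2006, §1.4 eq. (1.20) (p. 15); §3.8 (pp. 61–62)]
-/

noncomputable section

namespace Summit.CriticalPhenomena.PercolationContinuityZ3.Theorems

namespace FK

open SimpleGraph Literature.Probability.LatticeModels Literature.Probability.Percolation
open scoped Classical

variable {V : Type*} [Fintype V]

section Cycle3

variable {E₁ E₂ E₃ : Finset (Sym2 V)} {V₁ V₂ V₃ : Set V} {a m b : V}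

omit [Fintype V] in
/-- **Connection rule for a triangle of three networks** (`E₁` between `a, m`, `E₂` between `m, b`, `E₃` between `a, b`; `E₁, E₂` meet
only in `m`, and `E₁ ∪ E₂` meets `E₃` only inside `{a, b}`): `a ↔ b` in `γ₁ ∪ γ₂ ∪ γ₃` iff (`a ↔ m` in `γ₁` and `m ↔ b` in `γ₂`) or
`a ↔ b` in `γ₃`. [folklore] -/
theorem reachable_union_cycle3 (h₁ : ∀ e ∈ (↑E₁ : Set (Sym2 V)), ∀ z ∈ e, z ∈ V₁)
    (h₂ : ∀ e ∈ (↑E₂ : Set (Sym2 V)), ∀ z ∈ e, z ∈ V₂) (h₃ : ∀ e ∈ (↑E₃ : Set (Sym2 V)), ∀ z ∈ e, z ∈ V₃)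
    (h₁₂ : V₁ ∩ V₂ ⊆ {m}) (haV₂ : a ∉ V₂) (hbV₁ : b ∉ V₁) (ham : a ≠ m) (hbm : b ≠ m) (hab : a ≠ b)
    (h₃' : (V₁ ∪ V₂) ∩ V₃ ⊆ {a, b})
    {γ₁ γ₂ γ₃ : Finset (Sym2 V)} (hγ₁ : γ₁ ⊆ E₁) (hγ₂ : γ₂ ⊆ E₂) (hγ₃ : γ₃ ⊆ E₃) :
    (openGraph (↑(γ₁ ∪ γ₂ ∪ γ₃) : BondConfig V)).Reachable a b ↔
      ((openGraph (↑γ₁ : BondConfig V)).Reachable a m ∧ (openGraph (↑γ₂ : BondConfig V)).Reachable m b) ∨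
        (openGraph (↑γ₃ : BondConfig V)).Reachable a b := by
  have h₁₂' : ∀ e ∈ (↑(E₁ ∪ E₂) : Set (Sym2 V)), ∀ z ∈ e, z ∈ V₁ ∪ V₂ := by
    intro e he z hz
    rw [Finset.coe_union, Set.mem_union] at he
    rcases he with he | he
    · exact Or.inl (h₁ e he z hz)
    · exact Or.inr (h₂ e he z hz)
  rw [reachable_union_parallel h₁₂' h₃ h₃' (Finset.union_subset_union hγ₁ hγ₂) hγ₃,
    reachable_union_series h₁ h₂ h₁₂ haV₂ hbV₁ ham hbm hab hγ₁ hγ₂]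

/-- **THE TRIANGLE BRIDGE (antipodal exponent of a cycle of three networks).**  With `E₁` between `a, m`, `E₂` between `m, b`, `E₃`
between `a, b` as above (pairwise edge-disjoint), free sets `Mᵢ ⊆ Eᵢ`, contracted sets `Cᵢ ⊆ Eᵢ`, configurations `γᵢ ⊆ Mᵢ`, and
`c₁ = 1{a ↔ m in γ₁ ∪ C₁}`, `c₂ = 1{m ↔ b in γ₂ ∪ C₂}`, `c₃ = 1{a ↔ b in γ₃ ∪ C₃}`, `c̄ᵢ` the same for `(Mᵢ \ γᵢ) ∪ Cᵢ`:
`apExpC (M₁∪M₂∪M₃) (C₁∪C₂∪C₃) (γ₁∪γ₂∪γ₃) + 4|V| = Σᵢ apExpC Mᵢ Cᵢ γᵢ + [c₁ ∧ c₂ ∧ c₃] + [c̄₁ ∧ c̄₂ ∧ c̄₃]`.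
[cite: Grimmett2006, §1.4 eq. (1.20) (p. 15); §3.8 (pp. 61–62)] -/
theorem apExpC_cycle3 (hd₁₂ : Disjoint E₁ E₂) (hd₁₃ : Disjoint E₁ E₃) (hd₂₃ : Disjoint E₂ E₃)
    (h₁ : ∀ e ∈ (↑E₁ : Set (Sym2 V)), ∀ z ∈ e, z ∈ V₁) (h₂ : ∀ e ∈ (↑E₂ : Set (Sym2 V)), ∀ z ∈ e, z ∈ V₂)
    (h₃ : ∀ e ∈ (↑E₃ : Set (Sym2 V)), ∀ z ∈ e, z ∈ V₃)
    (h₁₂ : V₁ ∩ V₂ ⊆ {m}) (haV₂ : a ∉ V₂) (hbV₁ : b ∉ V₁) (ham : a ≠ m) (hbm : b ≠ m) (hab : a ≠ b)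
    (h₃' : (V₁ ∪ V₂) ∩ V₃ ⊆ {a, b})
    {M₁ M₂ M₃ C₁ C₂ C₃ γ₁ γ₂ γ₃ : Finset (Sym2 V)} (hM₁ : M₁ ⊆ E₁) (hM₂ : M₂ ⊆ E₂) (hM₃ : M₃ ⊆ E₃)
    (hC₁ : C₁ ⊆ E₁) (hC₂ : C₂ ⊆ E₂) (hC₃ : C₃ ⊆ E₃) (hγ₁ : γ₁ ⊆ M₁) (hγ₂ : γ₂ ⊆ M₂) (hγ₃ : γ₃ ⊆ M₃) :
    apExpC (M₁ ∪ M₂ ∪ M₃) (C₁ ∪ C₂ ∪ C₃) (γ₁ ∪ γ₂ ∪ γ₃) + 4 * Fintype.card V =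
      apExpC M₁ C₁ γ₁ + apExpC M₂ C₂ γ₂ + apExpC M₃ C₃ γ₃ +
        (if ((openGraph (↑(γ₁ ∪ C₁) : BondConfig V)).Reachable a m ∧ (openGraph (↑(γ₂ ∪ C₂) : BondConfig V)).Reachable m b) ∧
            (openGraph (↑(γ₃ ∪ C₃) : BondConfig V)).Reachable a b then 1 else 0) +
        (if ((openGraph (↑(M₁ \ γ₁ ∪ C₁) : BondConfig V)).Reachable a m ∧
              (openGraph (↑(M₂ \ γ₂ ∪ C₂) : BondConfig V)).Reachable m b) ∧
            (openGraph (↑(M₃ \ γ₃ ∪ C₃) : BondConfig V)).Reachable a b then 1 else 0) := by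
  -- the series pair (1,2)
  have k12 := apExpC_series hd₁₂ h₁ h₂ h₁₂ hM₁ hM₂ hC₁ hC₂ hγ₁ hγ₂
  -- the pair ((1,2),3) in parallel between a and b
  have hd : Disjoint (E₁ ∪ E₂) E₃ := Finset.disjoint_union_left.2 ⟨hd₁₃, hd₂₃⟩
  have h₁₂' : ∀ e ∈ (↑(E₁ ∪ E₂) : Set (Sym2 V)), ∀ z ∈ e, z ∈ V₁ ∪ V₂ := by
    intro e he z hz
    rw [Finset.coe_union, Set.mem_union] at he
    rcases he with he | he
    · exact Or.inl (h₁ e he z hz)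
    · exact Or.inr (h₂ e he z hz)
  have k := apExpC_parallel hd h₁₂' h₃ h₃' hab (Finset.union_subset_union hM₁ hM₂) hM₃
    (Finset.union_subset_union hC₁ hC₂) hC₃ (Finset.union_subset_union hγ₁ hγ₂) hγ₃
  -- the connection bits of the series pair
  have hdM : Disjoint M₁ M₂ := Finset.disjoint_of_subset_left hM₁ (Finset.disjoint_of_subset_right hM₂ hd₁₂)
  have hc : (openGraph (↑(γ₁ ∪ γ₂ ∪ (C₁ ∪ C₂)) : BondConfig V)).Reachable a b ↔
      (openGraph (↑(γ₁ ∪ C₁) : BondConfig V)).Reachable a m ∧ (openGraph (↑(γ₂ ∪ C₂) : BondConfig V)).Reachable m b := by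
    rw [union_union_glue]
    exact reachable_union_series h₁ h₂ h₁₂ haV₂ hbV₁ ham hbm hab (Finset.union_subset (hγ₁.trans hM₁) hC₁)
      (Finset.union_subset (hγ₂.trans hM₂) hC₂)
  have hcb : (openGraph (↑((M₁ ∪ M₂) \ (γ₁ ∪ γ₂) ∪ (C₁ ∪ C₂)) : BondConfig V)).Reachable a b ↔
      (openGraph (↑(M₁ \ γ₁ ∪ C₁) : BondConfig V)).Reachable a m ∧
        (openGraph (↑(M₂ \ γ₂ ∪ C₂) : BondConfig V)).Reachable m b := by
    rw [union_sdiff_union hdM hγ₁ hγ₂, union_union_glue]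
    exact reachable_union_series h₁ h₂ h₁₂ haV₂ hbV₁ ham hbm hab (Finset.union_subset (Finset.sdiff_subset.trans hM₁) hC₁)
      (Finset.union_subset (Finset.sdiff_subset.trans hM₂) hC₂)
  simp only [hc, hcb] at k
  omega

/-- **The triangle as a triple sum (regrouping by boxes).**  Under the hypotheses of `apExpC_cycle3`, a sum over the configurations of
the triangle of any quantity depending on the antipodal exponent (shifted by `4|V|`) and on the configuration is the triple sum over the
boxes' configurations with the exponent replaced by `Σᵢ apExpC Mᵢ Cᵢ γᵢ + [c₁∧c₂∧c₃] + [c̄₁∧c̄₂∧c̄₃]` (FK-Q2 §33).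
[cite: Grimmett2006, §1.4 eq. (1.20) (p. 15); §3.8 (pp. 61–62)] -/
theorem sum_powerset_cycle3 (hd₁₂ : Disjoint E₁ E₂) (hd₁₃ : Disjoint E₁ E₃) (hd₂₃ : Disjoint E₂ E₃)
    (h₁ : ∀ e ∈ (↑E₁ : Set (Sym2 V)), ∀ z ∈ e, z ∈ V₁) (h₂ : ∀ e ∈ (↑E₂ : Set (Sym2 V)), ∀ z ∈ e, z ∈ V₂)
    (h₃ : ∀ e ∈ (↑E₃ : Set (Sym2 V)), ∀ z ∈ e, z ∈ V₃)
    (h₁₂ : V₁ ∩ V₂ ⊆ {m}) (haV₂ : a ∉ V₂) (hbV₁ : b ∉ V₁) (ham : a ≠ m) (hbm : b ≠ m) (hab : a ≠ b)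
    (h₃' : (V₁ ∪ V₂) ∩ V₃ ⊆ {a, b})
    {M₁ M₂ M₃ C₁ C₂ C₃ : Finset (Sym2 V)} (hM₁ : M₁ ⊆ E₁) (hM₂ : M₂ ⊆ E₂) (hM₃ : M₃ ⊆ E₃)
    (hC₁ : C₁ ⊆ E₁) (hC₂ : C₂ ⊆ E₂) (hC₃ : C₃ ⊆ E₃) (Φ : ℕ → Finset (Sym2 V) → ℝ) :
    ∑ γ ∈ (M₁ ∪ M₂ ∪ M₃).powerset, Φ (apExpC (M₁ ∪ M₂ ∪ M₃) (C₁ ∪ C₂ ∪ C₃) γ + 4 * Fintype.card V) γ =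
      ∑ γ₁ ∈ M₁.powerset, ∑ γ₂ ∈ M₂.powerset, ∑ γ₃ ∈ M₃.powerset,
        Φ (apExpC M₁ C₁ γ₁ + apExpC M₂ C₂ γ₂ + apExpC M₃ C₃ γ₃ +
            (if ((openGraph (↑(γ₁ ∪ C₁) : BondConfig V)).Reachable a m ∧ (openGraph (↑(γ₂ ∪ C₂) : BondConfig V)).Reachable m b) ∧
                (openGraph (↑(γ₃ ∪ C₃) : BondConfig V)).Reachable a b then 1 else 0) +
            (if ((openGraph (↑(M₁ \ γ₁ ∪ C₁) : BondConfig V)).Reachable a m ∧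
                  (openGraph (↑(M₂ \ γ₂ ∪ C₂) : BondConfig V)).Reachable m b) ∧
                (openGraph (↑(M₃ \ γ₃ ∪ C₃) : BondConfig V)).Reachable a b then 1 else 0))
          (γ₁ ∪ γ₂ ∪ γ₃) := by
  have hd12M : Disjoint M₁ M₂ := Finset.disjoint_of_subset_left hM₁ (Finset.disjoint_of_subset_right hM₂ hd₁₂)
  have hd3M : Disjoint (M₁ ∪ M₂) M₃ :=
    Finset.disjoint_union_left.2 ⟨Finset.disjoint_of_subset_left hM₁ (Finset.disjoint_of_subset_right hM₃ hd₁₃),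
      Finset.disjoint_of_subset_left hM₂ (Finset.disjoint_of_subset_right hM₃ hd₂₃)⟩
  rw [sum_powerset_union_disj hd3M]
  rw [sum_powerset_union_disj hd12M]
  refine Finset.sum_congr rfl fun γ₁ hγ₁ => Finset.sum_congr rfl fun γ₂ hγ₂ => Finset.sum_congr rfl fun γ₃ hγ₃ => ?_
  rw [Finset.mem_powerset] at hγ₁ hγ₂ hγ₃
  rw [apExpC_cycle3 hd₁₂ hd₁₃ hd₂₃ h₁ h₂ h₃ h₁₂ haV₂ hbV₁ ham hbm hab h₃' hM₁ hM₂ hM₃ hC₁ hC₂ hC₃ hγ₁ hγ₂ hγ₃]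

/-- **The weighted antipodal form of a triangle, box by box** (companion of `FK.apPsiCW_theta3_eq`): the form
`Σ_γ w(apExpC M C γ)·(f(γ∪C) − f((M\γ)∪C))·(g(γ∪C) − g((M\γ)∪C))` of the triangle is the triple sum over the boxes' configurations with the
weight read at `Σᵢ apExpC Mᵢ Cᵢ γᵢ + [c₁∧c₂∧c₃] + [c̄₁∧c̄₂∧c̄₃] − 4|V|`. [cite: Grimmett2006, §1.4 eq. (1.20) (p. 15); §3.8 (pp. 61–62)] -/
theorem apPsiCW_cycle3_eq (hd₁₂ : Disjoint E₁ E₂) (hd₁₃ : Disjoint E₁ E₃) (hd₂₃ : Disjoint E₂ E₃)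
    (h₁ : ∀ e ∈ (↑E₁ : Set (Sym2 V)), ∀ z ∈ e, z ∈ V₁) (h₂ : ∀ e ∈ (↑E₂ : Set (Sym2 V)), ∀ z ∈ e, z ∈ V₂)
    (h₃ : ∀ e ∈ (↑E₃ : Set (Sym2 V)), ∀ z ∈ e, z ∈ V₃)
    (h₁₂ : V₁ ∩ V₂ ⊆ {m}) (haV₂ : a ∉ V₂) (hbV₁ : b ∉ V₁) (ham : a ≠ m) (hbm : b ≠ m) (hab : a ≠ b)
    (h₃' : (V₁ ∪ V₂) ∩ V₃ ⊆ {a, b})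
    {M₁ M₂ M₃ C₁ C₂ C₃ : Finset (Sym2 V)} (hM₁ : M₁ ⊆ E₁) (hM₂ : M₂ ⊆ E₂) (hM₃ : M₃ ⊆ E₃)
    (hC₁ : C₁ ⊆ E₁) (hC₂ : C₂ ⊆ E₂) (hC₃ : C₃ ⊆ E₃) (w : ℕ → ℝ) (f g : Finset (Sym2 V) → ℝ) :
    ∑ γ ∈ (M₁ ∪ M₂ ∪ M₃).powerset, w (apExpC (M₁ ∪ M₂ ∪ M₃) (C₁ ∪ C₂ ∪ C₃) γ) *
        ((f (γ ∪ (C₁ ∪ C₂ ∪ C₃)) - f ((M₁ ∪ M₂ ∪ M₃) \ γ ∪ (C₁ ∪ C₂ ∪ C₃))) *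
          (g (γ ∪ (C₁ ∪ C₂ ∪ C₃)) - g ((M₁ ∪ M₂ ∪ M₃) \ γ ∪ (C₁ ∪ C₂ ∪ C₃)))) =
      ∑ γ₁ ∈ M₁.powerset, ∑ γ₂ ∈ M₂.powerset, ∑ γ₃ ∈ M₃.powerset,
        w (apExpC M₁ C₁ γ₁ + apExpC M₂ C₂ γ₂ + apExpC M₃ C₃ γ₃ +
              (if ((openGraph (↑(γ₁ ∪ C₁) : BondConfig V)).Reachable a m ∧ (openGraph (↑(γ₂ ∪ C₂) : BondConfig V)).Reachable m b) ∧
                  (openGraph (↑(γ₃ ∪ C₃) : BondConfig V)).Reachable a b then 1 else 0) +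
              (if ((openGraph (↑(M₁ \ γ₁ ∪ C₁) : BondConfig V)).Reachable a m ∧
                    (openGraph (↑(M₂ \ γ₂ ∪ C₂) : BondConfig V)).Reachable m b) ∧
                  (openGraph (↑(M₃ \ γ₃ ∪ C₃) : BondConfig V)).Reachable a b then 1 else 0) -
            4 * Fintype.card V) *
          ((f (γ₁ ∪ γ₂ ∪ γ₃ ∪ (C₁ ∪ C₂ ∪ C₃)) - f (M₁ \ γ₁ ∪ (M₂ \ γ₂) ∪ (M₃ \ γ₃) ∪ (C₁ ∪ C₂ ∪ C₃))) *
            (g (γ₁ ∪ γ₂ ∪ γ₃ ∪ (C₁ ∪ C₂ ∪ C₃)) - g (M₁ \ γ₁ ∪ (M₂ \ γ₂) ∪ (M₃ \ γ₃) ∪ (C₁ ∪ C₂ ∪ C₃)))) := by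
  have hd12M : Disjoint M₁ M₂ := Finset.disjoint_of_subset_left hM₁ (Finset.disjoint_of_subset_right hM₂ hd₁₂)
  have hd3M : Disjoint (M₁ ∪ M₂) M₃ :=
    Finset.disjoint_union_left.2 ⟨Finset.disjoint_of_subset_left hM₁ (Finset.disjoint_of_subset_right hM₃ hd₁₃),
      Finset.disjoint_of_subset_left hM₂ (Finset.disjoint_of_subset_right hM₃ hd₂₃)⟩
  have key := sum_powerset_cycle3 hd₁₂ hd₁₃ hd₂₃ h₁ h₂ h₃ h₁₂ haV₂ hbV₁ ham hbm hab h₃' hM₁ hM₂ hM₃ hC₁ hC₂ hC₃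
    (fun n γ => w (n - 4 * Fintype.card V) *
      ((f (γ ∪ (C₁ ∪ C₂ ∪ C₃)) - f ((M₁ ∪ M₂ ∪ M₃) \ γ ∪ (C₁ ∪ C₂ ∪ C₃))) *
        (g (γ ∪ (C₁ ∪ C₂ ∪ C₃)) - g ((M₁ ∪ M₂ ∪ M₃) \ γ ∪ (C₁ ∪ C₂ ∪ C₃)))))
  simp only [Nat.add_sub_cancel] at key
  rw [key]
  refine Finset.sum_congr rfl fun γ₁ hγ₁ => Finset.sum_congr rfl fun γ₂ hγ₂ => Finset.sum_congr rfl fun γ₃ hγ₃ => ?_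
  rw [Finset.mem_powerset] at hγ₁ hγ₂ hγ₃
  rw [union_sdiff_union hd3M (Finset.union_subset_union hγ₁ hγ₂) hγ₃, union_sdiff_union hd12M hγ₁ hγ₂]

end Cycle3

end FK

end Summit.CriticalPhenomena.PercolationContinuityZ3.Theorems

end
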